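import Summits.Langlands.Langlands.Theorems.MonomialConverseAbelianFreeBrauerMoves

/-!
# Abelian-free Brauer induction, VI: expansions of virtual characters along admissible subgroups

Part of the sorry-free proof of the crux `Summit.Langlands.Langlands.Theses.MonomialConverse.AbelianFreeBrauer`
(item stmt-Langlands-18580, route-Langlands-MonomialConverse), split over the files
`MonomialConverseAbelianFreeBrauer{Span, Linear, Moves, Hubs, Affine, Expansion, Proof}` (landing
order; all definitions live in `Span`, the last file holds `abelianFreeBrauer_proof` and the proof
outline).  Everything is over the in-tree class-function library
`Literature.RepresentationTheory.FiniteGroups` (`indClassFun`, `classInner`, `virtChars`, `IsIrrChar`);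
no `sorry`, no new axioms, no `Prop`-valued definitions (predicates are sets).

Contents: closure properties of `admRem G adm` (the functions congruent modulo `J(G)` to a
`ℤ`-combination of `π_K · μ`, `K ∈ adm`, `μ` linear); `indClassFun_coe_mem_admRem` (a monomial
`Ind_H θ`, `H ∈ adm`, is a generator of `J` or a `π_H · μ`); **EXP-nil** `mem_admRem_of_isNilpotent`
(nilpotent groups are monomial, Serre §8.5 Thm. 16: every subgroup admissible); **EXP-Brauer**
`mem_admRem_of_not_nilpotent` (Brauer's theorem in the elementary form, Serre §10.5 Thm. 19: the
elementary subgroups are nilpotent hence proper, and on each of them `φ·f|` splits into its `J`-part —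
by `AFB⁰` of the proper subgroup — and its linear part); and `exists_hom_prime_order` (a nontrivial
linear character has a power of prime order).

References: Serre, *Linear Representations of Finite Groups* (`SerreLinearRepresentations1977`)
§8.5 Thm. 16, §10.5 Thm. 19; R. Brauer, Ann. of Math. 48 (1947) (`Brauer1947`).
-/

set_option linter.dupNamespace false

noncomputable section

open scoped BigOperators Pointwise

namespace Summit.Langlands.Langlands.Theorems.AbelianFreeBrauer

open Literature.RepresentationTheory.FiniteGroups

variable {G : Type} [Group G]

/-! ### Expansions of virtual characters along admissible subgroups -/

section Expansion

variable [Fintype G]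

/-- `J(G) ⊆ admRem adm`. [folklore] -/
theorem mem_admRem_of_mem_afSpan {adm : Set (Subgroup G)} {f : G → ℂ} (hf : f ∈ afSpan G) :
    f ∈ admRem G adm :=
  ⟨PEmpty, inferInstance, fun i => i.elim, fun i => i.elim, fun i => i.elim, fun i => i.elim,
    by rw [Fintype.sum_empty, sub_zero]; exact hf⟩

/-- `π_K · μ ∈ admRem adm` for `K ∈ adm`. [folklore] -/
theorem indOne_mul_mem_admRem {adm : Set (Subgroup G)} {K : Subgroup G} (hK : K ∈ adm)
    (μ : G →* ℂˣ) : (indOne K * fun g => (μ g : ℂ)) ∈ admRem G adm :=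
  ⟨Unit, inferInstance, fun _ => 1, fun _ => μ, fun _ => K, fun _ => hK, by
    simp only [Fintype.sum_unique, Int.cast_one, one_smul, sub_self]
    exact (afSpan G).zero_mem⟩

/-- `admRem adm` is closed under addition. [folklore] -/
theorem add_mem_admRem {adm : Set (Subgroup G)} {f g : G → ℂ} (hf : f ∈ admRem G adm)
    (hg : g ∈ admRem G adm) : f + g ∈ admRem G adm := by
  obtain ⟨ι₁, _, c₁, μ₁, K₁, hK₁, h₁⟩ := hf
  obtain ⟨ι₂, _, c₂, μ₂, K₂, hK₂, h₂⟩ := hg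
  refine ⟨ι₁ ⊕ ι₂, inferInstance, Sum.elim c₁ c₂, Sum.elim μ₁ μ₂, Sum.elim K₁ K₂, ?_, ?_⟩
  · rintro (i | i)
    exacts [hK₁ i, hK₂ i]
  · rw [Fintype.sum_sum_type]
    simp only [Sum.elim_inl, Sum.elim_inr]
    convert (afSpan G).add_mem h₁ h₂ using 1
    abel

/-- `admRem adm` is closed under integer multiples. [folklore] -/
theorem zsmul_mem_admRem {adm : Set (Subgroup G)} (m : ℤ) {f : G → ℂ} (hf : f ∈ admRem G adm) :
    (m : ℂ) • f ∈ admRem G adm := by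
  obtain ⟨ι, _, c, μ, K, hK, h⟩ := hf
  refine ⟨ι, inferInstance, fun i => m * c i, μ, K, hK, ?_⟩
  have h' := intCast_smul_mem_afSpan h m
  rw [smul_sub, Finset.smul_sum] at h'
  convert h' using 2
  refine Finset.sum_congr rfl fun i _ => ?_
  rw [Int.cast_mul, mul_smul]

/-- `admRem adm` is closed under negation. [folklore] -/
theorem neg_mem_admRem {adm : Set (Subgroup G)} {f : G → ℂ} (hf : f ∈ admRem G adm) :
    -f ∈ admRem G adm := by
  have h := zsmul_mem_admRem (-1) hf
  rwa [Int.cast_neg, Int.cast_one, neg_one_smul] at h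

/-- `admRem adm` is closed under finite sums. [folklore] -/
theorem sum_mem_admRem {adm : Set (Subgroup G)} {α : Type} (s : Finset α) {F : α → G → ℂ}
    (h : ∀ a ∈ s, F a ∈ admRem G adm) : ∑ a ∈ s, F a ∈ admRem G adm := by
  classical
  revert h
  refine Finset.induction_on s (fun _ => ?_) (fun a s ha ih h => ?_)
  · rw [Finset.sum_empty]
    exact mem_admRem_of_mem_afSpan (afSpan G).zero_mem
  · rw [Finset.sum_insert ha]
    exact add_mem_admRem (h a (Finset.mem_insert_self a s))
      (ih fun b hb => h b (Finset.mem_insert_of_mem hb))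

/-- A monomial character `Ind_H θ` with `H ∈ adm` lies in `admRem adm`: either `θ` is abelian-free
(a generator of `J(G)`) or `θ = μ|_H` and `Ind_H θ = π_H · μ`. [folklore] -/
theorem indClassFun_coe_mem_admRem {adm : Set (Subgroup G)} {H : Subgroup G} (hH : H ∈ adm)
    (θ : H →* ℂˣ) : indClassFun H (fun h => (θ h : ℂ)) ∈ admRem G adm := by
  classical
  by_cases haf : ∀ χ : G →* ℂˣ, χ.restrict H ≠ θ
  · exact mem_admRem_of_mem_afSpan (indClassFun_mem_afSpan haf)
  · push Not at haf
    obtain ⟨μ, hμ⟩ := haf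
    have h1 : (fun h : H => (θ h : ℂ)) = fun h : H => (fun g : G => (μ g : ℂ)) (h : G) := by
      funext h
      rw [← hμ, MonoidHom.restrict_apply]
    rw [h1, indClassFun_restrict H (isCharacter_coe_monoidHom' μ).isClassFun]
    exact indOne_mul_mem_admRem hH μ

/-- (EXP-nil) In a nilpotent group every virtual character is, modulo `J(G)`, a `ℤ`-combination
of `π_K · μ` over arbitrary subgroups `K` (nilpotent groups are monomial, Serre §8.5 Thm. 16).
[cite: SerreLinearRepresentations1977, §8.5 Thm. 16] -/
theorem mem_admRem_of_isNilpotent [Group.IsNilpotent G] {f : G → ℂ} (hf : f ∈ virtChars G) :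
    f ∈ admRem G Set.univ := by
  classical
  rw [mem_virtChars] at hf
  refine AddSubgroup.closure_induction (p := fun g _ => g ∈ admRem G Set.univ) ?_ ?_ ?_ ?_ hf
  · intro χ hχ
    obtain ⟨ι, _, H, θ, hsum⟩ := (IsIrrChar.isCharacter hχ).isMonomialSum_of_isNilpotent
    rw [hsum]
    exact sum_mem_admRem _ fun i _ => indClassFun_coe_mem_admRem (Set.mem_univ _) (θ i)
  · exact mem_admRem_of_mem_afSpan (afSpan G).zero_mem
  · intro x y _ _ hx hy
    exact add_mem_admRem hx hy
  · intro x _ hx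
    exact neg_mem_admRem hx

/-- (EXP-Brauer) In a non-nilpotent group every virtual character is, modulo `J(G)`, a
`ℤ`-combination of `π_K · μ` over **proper** subgroups `K`, granted `AFB⁰` of the proper
subgroups: Brauer's theorem in the elementary form writes `1_G = ∑ nᵢ Ind_{Eᵢ} φᵢ` with `Eᵢ`
elementary (nilpotent, hence proper), so `f = ∑ nᵢ Ind_{Eᵢ}(φᵢ · f|_{Eᵢ})`, and on each `Eᵢ`
the virtual character `φᵢ f|` splits as (its `J(Eᵢ)`-part) + (its linear part).
[cite: SerreLinearRepresentations1977, §10.5 Thm. 19] -/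
theorem mem_admRem_of_not_nilpotent (hG : ¬ Group.IsNilpotent G)
    (hsub : ∀ (M : Subgroup G) [Fintype M], M ≠ ⊤ → linOrth M ⊆ (afSpan M : Set (M → ℂ)))
    {f : G → ℂ} (hf : f ∈ virtChars G) : f ∈ admRem G {K | K ≠ ⊤} := by
  classical
  obtain ⟨ι, hι, E, φ, n, hE, hφ, heq⟩ := brauer_induction_elementary_holds G 1 isCharacter_one
  have hEt : ∀ i, E i ≠ ⊤ := by
    intro i h
    obtain ⟨p, hp, hel⟩ := hE i
    haveI : Group.IsNilpotent (E i) := hel.isNilpotent hp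
    exact hG (Group.nilpotent_of_mulEquiv ((MulEquiv.subgroupCongr h).trans Subgroup.topEquiv))
  have hfc : IsClassFun f := isClassFun_of_mem_virtChars hf
  have hf1 : f = ∑ i, (n i : ℂ) • indClassFun (E i) (fun x : E i => φ i x * f x) := by
    conv_lhs => rw [← mul_one f, heq, Finset.mul_sum]
    refine Finset.sum_congr rfl fun i _ => ?_
    rw [mul_smul_comm, mul_comm f _, indClassFun_mul_restrict (E i) (φ i) hfc]
  rw [hf1]
  refine sum_mem_admRem _ fun i _ => zsmul_mem_admRem (n i) ?_
  set ψ : E i → ℂ := fun x => φ i x * f x with hψdef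
  have hψ : ψ ∈ virtChars (E i) :=
    Subring.mul_mem _ (hφ i).mem_virtChars (restrict_mem_virtChars (E i) hf)
  have hsplit : ψ = (ψ - linPart (E i) ψ) + ∑ θ ∈ linF (E i), classInner ψ θ • θ := by
    rw [show (∑ θ ∈ linF (E i), classInner ψ θ • θ) = linPart (E i) ψ from rfl, sub_add_cancel]
  rw [hsplit, indClassFun_add, indClassFun_sum]
  refine add_mem_admRem ?_ (sum_mem_admRem _ fun θ hθ => ?_)
  · exact mem_admRem_of_mem_afSpan
      (indClassFun_mem_afSpan_of_mem (E i) (sub_linPart_mem_afSpan (hsub (E i) (hEt i)) hψ))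
  · obtain ⟨m, hm⟩ := exists_int_classInner_of_mem_virtChars hψ (mem_linF.mp hθ).1
    rw [indClassFun_smul, hm]
    refine zsmul_mem_admRem m ?_
    obtain ⟨ν, hν⟩ := exists_hom_of_mem_linF hθ
    rw [← hν]
    exact indClassFun_coe_mem_admRem (hEt i) ν

/-- A nontrivial linear character has a power which is a nontrivial linear character of prime
order. [folklore] -/
theorem exists_hom_prime_order {μ : G →* ℂˣ} (hμ : μ ≠ 1) :
    ∃ (p : ℕ) (μ₀ : G →* ℂˣ), p.Prime ∧ μ₀ ≠ 1 ∧ μ₀ ^ p = 1 := by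
  have hfin : IsOfFinOrder μ := by
    refine isOfFinOrder_iff_pow_eq_one.mpr ⟨Fintype.card G, Fintype.card_pos, ?_⟩
    refine MonoidHom.ext fun g => ?_
    rw [MonoidHom.pow_apply, ← map_pow, pow_card_eq_one, map_one, MonoidHom.one_apply]
  have hpos : 0 < orderOf μ := hfin.orderOf_pos
  have hne1 : orderOf μ ≠ 1 := fun h => hμ (orderOf_eq_one_iff.mp h)
  have h2 := orderOf_pow_orderOf_div hpos.ne' (Nat.minFac_dvd (orderOf μ))
  refine ⟨(orderOf μ).minFac, μ ^ (orderOf μ / (orderOf μ).minFac), Nat.minFac_prime hne1, ?_, ?_⟩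
  · intro h
    rw [h, orderOf_one] at h2
    exact (Nat.minFac_prime hne1).one_lt.ne' h2.symm
  · have h3 := pow_orderOf_eq_one (μ ^ (orderOf μ / (orderOf μ).minFac))
    rwa [h2] at h3

end Expansion

end Summit.Langlands.Langlands.Theorems.AbelianFreeBrauer

end
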